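import Summits.ValiantsHypothesis.ValiantsHypothesis.Theorems.ZeroOneTransfer.Negative.TopComponentFree
import Summits.ValiantsHypothesis.ValiantsHypothesis.Theorems.DivisionGapPerDivisionHardStubJssContraction
import Literature.Computability.AlgebraicComplexity.ArithCircuitProofs

/-!
# Crux `DivisionGap.ZeroOneTransfer` (stmt-ValiantsHypothesis-5066), line `charged-uncharged` —
stub `cofactorCharging_monomialTop`: the partial charging theorem

Support file for crux `stmt-ValiantsHypothesis-5066` (`Theses.DivisionGap.ZeroOneTransfer`, H2 of
route DivisionGap), line `charged-uncharged` (lead c8).  The crux splits as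
`MonotoneMultiples ∧ CofactorCharging` (`Theorems/DivisionGapZeroOneTransferSplit.lean`);
`CofactorCharging` says that an expensive cofactor `h` of a monotone certificate `f · h` can be
traded for a cheap one.  This file proves the part of it that is a theorem today, in the tree's
fan-in-two monotone model `complexity` over the semiring `ℝ≥0` and the `n²` variables `x_ij`:

`cofactorCharging_monomialTop : ∃ κ, ∀ n w f h d u c, f w-homogeneous → c ≠ 0 →
   top_w h = c · x^u → L(f) ≤ ((n + 2) (L(f · h) + 3))^κ`.

If `f` is `w`-homogeneous and the `w`-initial form of `h` is a single monomial `c · x^u`, the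
cofactor can be dropped (`h' = 1`) at polynomial cost.  Proof: initial forms are multiplicative and
free over `ℝ≥0` (`Negative.topComponent_mul`, `Negative.complexity_topComponent_le`), so
`L(f · c x^u) = L(top_w (f h)) ≤ L(f h)`; one scalar gate gives `L(x^u · f) ≤ L(f h) + 1`
(`x^u · f = c⁻¹ • (f · c x^u)`); and the Jukna–Seiwert–Sergeev contraction
(`DivisionGapPerDivisionHard.stub_jssContraction`, JuknaSeiwertSergeev2022 Lemma 2) removes the
monomial cofactor at cost `((n + 2)(L(x^u f) + 2))^κ`.  No definitions in this file.
-/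

noncomputable section

-- Sub = Summit single-conjunct layout: the duplicated namespace component is mandated by the tree.
set_option linter.dupNamespace false

namespace Summit.ValiantsHypothesis.ValiantsHypothesis.Theorems.DivisionGapZeroOneTransfer

open Literature.Computability.AlgebraicComplexity
open Summit.ValiantsHypothesis.ValiantsHypothesis.Theorems.ZeroOneTransfer
open MvPolynomial
open scoped NNReal

namespace MonomialTop

variable {σ : Type*}

/-- Rescaling a monomial cofactor: `x^u · f = c⁻¹ • (f · c x^u)` for `c ≠ 0` in `ℝ≥0`.
[folklore] -/
theorem monomial_one_mul_eq_smul (f : MvPolynomial σ ℝ≥0) (u : σ →₀ ℕ) {c : ℝ≥0} (hc : c ≠ 0) :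
    monomial u (1 : ℝ≥0) * f = c⁻¹ • (f * monomial u c) := by
  rw [← mul_smul_comm, smul_monomial, smul_eq_mul, inv_mul_cancel₀ hc, mul_comm]

/-- One scalar gate trades the monomial cofactor `c x^u` for `x^u`:
`L(x^u · f) ≤ L(f · c x^u) + 1` for `c ≠ 0`. [folklore] -/
theorem complexity_monomial_one_mul_le (f : MvPolynomial σ ℝ≥0) (u : σ →₀ ℕ) {c : ℝ≥0}
    (hc : c ≠ 0) : complexity (monomial u (1 : ℝ≥0) * f) ≤ complexity (f * monomial u c) + 1 := by
  rw [monomial_one_mul_eq_smul f u hc]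
  exact complexity_smul_le_holds c⁻¹ (f * monomial u c)

/-- If `f` is `w`-homogeneous and `top_w h = c x^u`, then `top_w (f h) = f · c x^u`, hence
`L(f · c x^u) ≤ L(f h)` (initial forms are multiplicative and free over `ℝ≥0`). [folklore] -/
theorem complexity_mul_monomial_le (w : σ → ℕ) {f : MvPolynomial σ ℝ≥0} (h : MvPolynomial σ ℝ≥0)
    {d : ℕ} {u : σ →₀ ℕ} {c : ℝ≥0} (hf : IsWeightedHomogeneous w f d)
    (hh : Negative.topComponent w h = monomial u c) :
    complexity (f * monomial u c) ≤ complexity (f * h) := by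
  have htop : Negative.topComponent w (f * h) = f * monomial u c := by
    rw [Negative.topComponent_mul, Negative.topComponent_eq_self_of_isWeightedHomogeneous w hf, hh]
  rw [← htop]
  exact Negative.complexity_topComponent_le w (f * h)

end MonomialTop

open MonomialTop in
/-- **The partial charging theorem (stub `cofactorCharging_monomialTop` of line
`charged-uncharged`).**  In the monotone fan-in-two model over `ℝ≥0`: if `f` is `w`-homogeneous
and the `w`-initial form of the cofactor `h` is a single monomial `c · x^u` (`c ≠ 0`), then the
cofactor can be dropped at polynomial cost, `L(f) ≤ ((n + 2)(L(f · h) + 3))^κ` for an absolute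
`κ` — initial forms are free (`L(f · c x^u) ≤ L(f h)`), one scalar gate normalises `c`, and the
Jukna–Seiwert–Sergeev contraction removes the monomial `x^u`.
[cite: JuknaSeiwertSergeev2022, Lemma 2] -/
theorem cofactorCharging_monomialTop : ∃ κ : ℕ, ∀ (n : ℕ) (w : Fin n × Fin n → ℕ) (f h : MvPolynomial (Fin n × Fin n) NNReal) (d : ℕ) (u : (Fin n × Fin n) →₀ ℕ) (c : NNReal), MvPolynomial.IsWeightedHomogeneous w f d → c ≠ 0 → Summit.ValiantsHypothesis.ValiantsHypothesis.Theorems.ZeroOneTransfer.Negative.topComponent w h = MvPolynomial.monomial u c → Literature.Computability.AlgebraicComplexity.complexity f ≤ ((n + 2) * (Literature.Computability.AlgebraicComplexity.complexity (f * h) + 3)) ^ κ := by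
  obtain ⟨κ, hκ⟩ := DivisionGapPerDivisionHard.stub_jssContraction
  refine ⟨κ, fun n w f h d u c hf hc hh => ?_⟩
  have h1 : complexity (monomial u (1 : ℝ≥0) * f) ≤ complexity (f * h) + 1 :=
    (complexity_monomial_one_mul_le f u hc).trans
      (Nat.add_le_add_right (complexity_mul_monomial_le w h hf hh) 1)
  calc complexity f ≤ ((n + 2) * (complexity (monomial u (1 : ℝ≥0) * f) + 2)) ^ κ := hκ n f u
    _ ≤ ((n + 2) * (complexity (f * h) + 3)) ^ κ :=
      Nat.pow_le_pow_left (Nat.mul_le_mul_left (n + 2) (by omega)) κ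

end Summit.ValiantsHypothesis.ValiantsHypothesis.Theorems.DivisionGapZeroOneTransfer

end
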